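import Summits.Ventures.CertifiedQuantumChemistry.Certificates.HubbardRingL4SectorDualPairPoly
import HarnessLib

/-!
# Ventures/CertifiedQuantumChemistry — Certificates/HubbardRingL4SectorDualPairPoly2.lean: block families with COLUMNS over `ℚ(√2)`
# — `Z(ε) = S(ε)·(P_r + √2 P_s)·S(ε)ᵀ` with `S(ε) = Σ_d ε^d (S_r d + √2 S_s d)`: the `ε`-expansion tables of its rational and `√2` parts
# from four RATIONAL kernel identities, and its positive semidefiniteness from two `ExactLDL` verdicts on the core

HONEST FRAMING (verbatim): certified bounds for a stated model Hamiltonian in a stated basis; not a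
claim about the real molecule beyond that model. A CERTIFICATE FORMAT statement: no model value, no row, no claim node.

Seat rdm-B (gen 45); companion of `Certificates/HubbardRingL4SectorDualPairPoly.lean` (same gen). In the level-DQG dual certificate
family of the 4-ring the `(↑,↓)` / `(↓,↑)` particle–hole blocks need dual columns whose coefficients lie in `ℚ(√2)` (the admissible
`ε¹` directions of those blocks form an irrational plane — facial reduction of the finite-`U` programme). This file extends §2 of the
companion to such columns, still without any `ℚ(√2)` arithmetic in the kernel:
* §1 `sum_smul_eq_mul_of_tables` — the purely real algebra: if `Rz d = P·(S d)ᵀ` and `T m = Σ_{d₁+d₂=m} S d₁·Rz d₂` entrywise then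
  `Σ_m ε^m·T m = S(ε)·P·S(ε)ᵀ` (`S(ε) = Σ_d ε^d S d`; real matrices, no casts);
* §2 **`posSemidef_realPoly_pair2_of_tables`** — with rational tables `S_r, S_s, P_r, P_s, R_r, R_s, T_r, T_s` satisfying the four
  identities `R_r = P_r S_rᵀ + 2 P_s S_sᵀ`, `R_s = P_r S_sᵀ + P_s S_rᵀ`, `T_r = conv(S_r, R_r) + 2 conv(S_s, R_s)`, `T_s = conv(S_r, R_s) +
  conv(S_s, R_r)` (decidable) and the two `ExactLDL` verdicts on `P_r + q₁P_s`, `P_r + q₂P_s` (`0 ≤ q₁`, `q₁² ≤ 2 ≤ q₂²`):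
  `realPoly T_r ε + √2 • realPoly T_s ε ⪰ 0` over `ℝ` for every real `ε` — the shape consumed by `realZ_pair_scatter` /
  `Dual.le_of_check_sector_pair`.
0 sorry, 0 def; standard axioms. References (docstring-only): R. A. Horn, C. R. Johnson, Matrix Analysis (2nd ed.) Obs. 7.1.8 (congruence
preserves positive semidefiniteness).
-/

set_option linter.style.longLine false

namespace Summit.Ventures.CertifiedQuantumChemistry

namespace DualL4

open Matrix Finset BlockScatter

/-! ## §1 The real algebra `Σ_m ε^m·T m = S(ε)·P·S(ε)ᵀ` -/

section RealAlgebra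

variable {dim r : ℕ}

/-- type-directed swap `Σ_{Fin 3} Σ_{Fin r} → Σ_{Fin r} Σ_{Fin 3}` -/
private theorem sum_comm_3r' {M : Type*} [AddCommMonoid M] (g : Fin 3 → Fin r → M) :
    ∑ d : Fin 3, ∑ k : Fin r, g d k = ∑ k : Fin r, ∑ d : Fin 3, g d k := Finset.sum_comm

/-- **Real tables.** If `Rz d = P·(S d)ᵀ` and `T m = Σ_{d₁+d₂=m} S d₁ · Rz d₂` entrywise (`d < 3`, `m < 5`) then
`Σ_m ε^m·T m = S(ε)·P·S(ε)ᵀ` with `S(ε) = Σ_d ε^d·S d`. -/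
theorem sum_smul_eq_mul_of_tables (S : Fin 3 → Matrix (Fin dim) (Fin r) ℝ) (P : Matrix (Fin r) (Fin r) ℝ)
    (Rz : Fin 3 → Matrix (Fin r) (Fin dim) ℝ) (T : Fin 5 → Matrix (Fin dim) (Fin dim) ℝ)
    (hR : ∀ (d : Fin 3) (k : Fin r) (b : Fin dim), Rz d k b = ∑ l : Fin r, P k l * S d b l)
    (hT : ∀ (m : Fin 5) (a b : Fin dim), T m a b =
      ∑ d₁ : Fin 3, ∑ d₂ : Fin 3, if (d₁ : ℕ) + d₂ = m then ∑ k : Fin r, S d₁ a k * Rz d₂ k b else 0) (ε : ℝ) :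
    ∑ m : Fin 5, ε ^ (m : ℕ) • T m = (∑ d : Fin 3, ε ^ (d : ℕ) • S d) * P * (∑ d : Fin 3, ε ^ (d : ℕ) • S d)ᵀ := by
  ext a b
  set X : Fin 3 → Fin 3 → ℝ := fun d₁ d₂ => ∑ k : Fin r, S d₁ a k * Rz d₂ k b with hX
  have lhs : (∑ m : Fin 5, ε ^ (m : ℕ) • T m) a b = ∑ d₁ : Fin 3, ∑ d₂ : Fin 3, ε ^ ((d₁ : ℕ) + d₂) * X d₁ d₂ := by
    simp only [Matrix.sum_apply, Matrix.smul_apply, hT, smul_eq_mul, hX]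
    simp only [Fin.sum_univ_five, Fin.sum_univ_three, Fin.isValue, Fin.val_zero, Fin.val_one, Fin.val_two]
    norm_num
    ring
  have rhs : ((∑ d : Fin 3, ε ^ (d : ℕ) • S d) * P * (∑ d : Fin 3, ε ^ (d : ℕ) • S d)ᵀ) a b =
      ∑ d₁ : Fin 3, ∑ d₂ : Fin 3, ε ^ ((d₁ : ℕ) + d₂) * X d₁ d₂ := by
    have hXe : ∀ d₁ d₂ : Fin 3, X d₁ d₂ = ∑ k : Fin r, ∑ l : Fin r, S d₁ a k * (P k l * S d₂ b l) := by
      intro d₁ d₂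
      simp only [hX, hR, Finset.mul_sum]
    have L1 : ((∑ d : Fin 3, ε ^ (d : ℕ) • S d) * P * (∑ d : Fin 3, ε ^ (d : ℕ) • S d)ᵀ) a b =
        ∑ k : Fin r, ∑ l : Fin r, (∑ d : Fin 3, ε ^ (d : ℕ) • S d) a k * P k l * (∑ d : Fin 3, ε ^ (d : ℕ) • S d) b l := by
      simp only [Matrix.mul_apply, Matrix.transpose_apply, Finset.sum_mul]
      rw [Finset.sum_comm]
    have R1 : ∑ d₁ : Fin 3, ∑ d₂ : Fin 3, ε ^ ((d₁ : ℕ) + d₂) * X d₁ d₂ =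
        ∑ k : Fin r, ∑ l : Fin r, ∑ d₁ : Fin 3, ∑ d₂ : Fin 3, ε ^ ((d₁ : ℕ) + d₂) * (S d₁ a k * (P k l * S d₂ b l)) := by
      simp only [hXe, Finset.mul_sum, sum_comm_3r' (r := r)]
    rw [L1, R1]
    refine Finset.sum_congr rfl fun k _ => Finset.sum_congr rfl fun l _ => ?_
    simp only [Matrix.sum_apply, Matrix.smul_apply, smul_eq_mul, Fin.sum_univ_three, Fin.isValue, Fin.val_zero, Fin.val_one,
      Fin.val_two]
    ring
  rw [lhs, rhs]

end RealAlgebra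

/-! ## §2 Block families with `ℚ(√2)` columns from rational kernel identities -/

section Pair2

variable {dim r : ℕ}

/-- `√2·√2 = 2`. -/
private theorem sqrt_two_mul_self : Real.sqrt 2 * Real.sqrt 2 = 2 := Real.mul_self_sqrt (by norm_num)

/-- **A `ℚ(√2)`-COLUMN block family is positive semidefinite.** Columns `S(ε) = Σ_d ε^d (S_r d + √2 S_s d)`, core `P_r + √2 P_s`
(symmetric parts, `ExactLDL`-accepted at two rational points `q₁ ≤ √2 ≤ q₂` of the segment), shipped tables `R_r, R_s, T_r, T_s` with the
four rational identities of the `ℚ(√2)` products: then `realPoly T_r ε + √2 • realPoly T_s ε = S(ε)·(P_r + √2P_s)·S(ε)ᵀ ⪰ 0`. -/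
theorem posSemidef_realPoly_pair2_of_tables (Sr Ss : Fin 3 → Matrix (Fin dim) (Fin r) ℚ) (Pr Ps : Matrix (Fin r) (Fin r) ℚ)
    (Rr Rs : Fin 3 → Matrix (Fin r) (Fin dim) ℚ) (Tr Ts : Fin 5 → Matrix (Fin dim) (Fin dim) ℚ) (q₁ q₂ : ℚ)
    (hq₁ : 0 ≤ q₁) (hq₁' : q₁ ^ 2 ≤ 2) (hq₂ : 0 ≤ q₂) (hq₂' : 2 ≤ q₂ ^ 2)
    (hr : ∀ k l : Fin r, Pr k l = Pr l k) (hs : ∀ k l : Fin r, Ps k l = Ps l k)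
    (hacc1 : ExactLDL.ldlAccept r (Pr + q₁ • Ps) = true) (hacc2 : ExactLDL.ldlAccept r (Pr + q₂ • Ps) = true)
    (hRr : ∀ (d : Fin 3) (k : Fin r) (b : Fin dim), Rr d k b = ∑ l : Fin r, (Pr k l * Sr d b l + 2 * (Ps k l * Ss d b l)))
    (hRs : ∀ (d : Fin 3) (k : Fin r) (b : Fin dim), Rs d k b = ∑ l : Fin r, (Pr k l * Ss d b l + Ps k l * Sr d b l))
    (hTr : ∀ (m : Fin 5) (a b : Fin dim), Tr m a b = polyConv Sr Rr m a b + 2 * polyConv Ss Rs m a b)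
    (hTs : ∀ (m : Fin 5) (a b : Fin dim), Ts m a b = polyConv Sr Rs m a b + polyConv Ss Rr m a b) (ε : ℝ) :
    (realPoly Tr ε + Real.sqrt 2 • realPoly Ts ε).PosSemidef := by
  -- the real tables
  set S : Fin 3 → Matrix (Fin dim) (Fin r) ℝ := fun d => (Sr d).map (Rat.cast : ℚ → ℝ) + Real.sqrt 2 • (Ss d).map (Rat.cast : ℚ → ℝ) with hS
  set P : Matrix (Fin r) (Fin r) ℝ := Pr.map (Rat.cast : ℚ → ℝ) + Real.sqrt 2 • Ps.map (Rat.cast : ℚ → ℝ) with hP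
  set Rz : Fin 3 → Matrix (Fin r) (Fin dim) ℝ := fun d => (Rr d).map (Rat.cast : ℚ → ℝ) + Real.sqrt 2 • (Rs d).map (Rat.cast : ℚ → ℝ) with hRz
  set T : Fin 5 → Matrix (Fin dim) (Fin dim) ℝ := fun m => (Tr m).map (Rat.cast : ℚ → ℝ) + Real.sqrt 2 • (Ts m).map (Rat.cast : ℚ → ℝ) with hTT
  have h2 := sqrt_two_mul_self
  have hR : ∀ (d : Fin 3) (k : Fin r) (b : Fin dim), Rz d k b = ∑ l : Fin r, P k l * S d b l := by
    intro d k b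
    simp only [hRz, hP, hS, Matrix.add_apply, Matrix.smul_apply, Matrix.map_apply, smul_eq_mul, hRr, hRs]
    push_cast
    simp only [Finset.mul_sum, ← Finset.sum_add_distrib]
    refine Finset.sum_congr rfl fun l _ => ?_
    linear_combination (-(((Ps k l : ℚ) : ℝ) * ((Ss d b l : ℚ) : ℝ))) * h2
  have hT' : ∀ (m : Fin 5) (a b : Fin dim), T m a b =
      ∑ d₁ : Fin 3, ∑ d₂ : Fin 3, if (d₁ : ℕ) + d₂ = m then ∑ k : Fin r, S d₁ a k * Rz d₂ k b else 0 := by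
    intro m a b
    simp only [hTT, hS, hRz, Matrix.add_apply, Matrix.smul_apply, Matrix.map_apply, smul_eq_mul, hTr, hTs, polyConv,
      Rat.cast_add, Rat.cast_mul, Rat.cast_sum, Rat.cast_ofNat, apply_ite (Rat.cast : ℚ → ℝ), Rat.cast_zero]
    simp only [Finset.mul_sum, mul_add, ← Finset.sum_add_distrib, mul_ite, mul_zero]
    refine Finset.sum_congr rfl fun d₁ _ => Finset.sum_congr rfl fun d₂ _ => ?_
    split_ifs
    · simp only [← Finset.sum_add_distrib, add_mul]
      refine Finset.sum_congr rfl fun k _ => ?_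
      linear_combination (-(((Ss d₁ a k : ℚ) : ℝ) * ((Rs d₂ k b : ℚ) : ℝ))) * h2
    · simp
  have e : realPoly Tr ε + Real.sqrt 2 • realPoly Ts ε = ∑ m : Fin 5, ε ^ (m : ℕ) • T m := by
    simp only [realPoly, hTT, smul_add, Finset.sum_add_distrib, Finset.smul_sum, smul_comm (Real.sqrt 2)]
  rw [e, sum_smul_eq_mul_of_tables S P Rz T hR hT' ε]
  have hPsd : P.PosSemidef := posSemidef_ratCast_add_sqrt_two_smul Pr Ps q₁ q₂ hq₁ hq₁' hq₂ hq₂' hr hs hacc1 hacc2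
  have h := hPsd.mul_mul_conjTranspose_same (∑ d : Fin 3, ε ^ (d : ℕ) • S d)
  rwa [Matrix.conjTranspose_eq_transpose_of_trivial] at h

end Pair2

end DualL4

end Summit.Ventures.CertifiedQuantumChemistry
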